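import Mathlib
import Summits.Ventures.PercRepro.TriangleCapVertexDecomposition

/-!
# PercRepro — THE LEVEL LOCUS: THE EXTREMAL GRAPHS OF THE VERTEX BOUND ARE THE STARS OF OFF-EDGES HUNG ON `N(w)`
(p3, gen 50; part 216)

Part 215 reads the vertex bound `Σ d² + 2 t (d(w) − 1) ≤ s (s + 1)` (`t = s − d(w)` off-edges) with its equality case:
every off-edge meets `N(w)` and every two off-edges share a vertex.  Here the second condition is made structural:
in a triangle-free graph, pairwise intersecting edges have a COMMON vertex (`common_vertex_of_pairwise_inter`:
three pairwise intersecting edges without a common vertex form a triangle), and the first condition is made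
pointwise (`attach_eq_card_iff`: `attach = t` iff `|N(w) ∩ e| = 1` for every off-edge `e`).  Hence
(`level_locus`, `t ≥ 2`, `w` not isolated): a triangle-free graph at the vertex bound of `w` has its off-edges
forming a `t`-star at a vertex `u` with every edge of the star meeting `N(w)` in exactly one vertex — either `u ∈
N(w)` and the star hangs at the leaf `u` of `w` with its other ends outside `N(w)` (the `(s − t)`-star plus a
`t`-star at a leaf: the extremal graph of §10cc's level-`(t − 1)` stability), or `u ∉ N(w)` and `u` is joined to `t`
leaves of `w` (the `K_{2,t}` through `w`).  The converse (`vertex_bound_eq_of_star`) is the formula read backwards.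

Axioms: standard.
-/

namespace PercRepro

namespace TriangleCap

namespace C047

open Finset

variable {V : Type*} [Fintype V] [DecidableEq V]

/-- **PAIRWISE INTERSECTING EDGES OF A TRIANGLE-FREE GRAPH HAVE A COMMON VERTEX** (`|F| ≥ 2`). -/
theorem common_vertex_of_pairwise_inter (H : SimpleGraph V) [DecidableRel H.Adj] (hfree : H.CliqueFree 3)
    (F : Finset (Sym2 V)) (hF : F ⊆ H.edgeFinset) (h2 : 2 ≤ F.card)
    (hpair : ∀ e ∈ F, ∀ f ∈ F, e ≠ f → ∃ v, v ∈ e ∧ v ∈ f) : ∃ u, ∀ e ∈ F, u ∈ e := by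
  obtain ⟨e, he, f, hf, hef⟩ := one_lt_card.mp (by omega : 1 < F.card)
  obtain ⟨u, hue, huf⟩ := hpair e he f hf hef
  refine ⟨u, fun g hg => ?_⟩
  by_contra hug
  -- `g` meets `e` at the other end `x` of `e` and `f` at the other end `y` of `f`
  obtain ⟨x, hxg, hxe⟩ : ∃ x, x ∈ g ∧ x ∈ e := by
    obtain ⟨x, hxg, hxe⟩ := hpair g hg e he (fun h => hug (h ▸ hue))
    exact ⟨x, hxg, hxe⟩
  obtain ⟨y, hyg, hyf⟩ : ∃ y, y ∈ g ∧ y ∈ f := by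
    obtain ⟨y, hyg, hyf⟩ := hpair g hg f hf (fun h => hug (h ▸ huf))
    exact ⟨y, hyg, hyf⟩
  have hxu : x ≠ u := fun h => hug (h ▸ hxg)
  have hyu : y ≠ u := fun h => hug (h ▸ hyg)
  have hex : e = s(u, x) := (Sym2.mem_and_mem_iff hxu.symm).mp ⟨hue, hxe⟩
  have hfy : f = s(u, y) := (Sym2.mem_and_mem_iff hyu.symm).mp ⟨huf, hyf⟩
  have hxy : x ≠ y := by
    intro h
    subst h
    exact hef (hex.trans hfy.symm)
  have hgxy : g = s(x, y) := (Sym2.mem_and_mem_iff hxy).mp ⟨hxg, hyg⟩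
  have hux : H.Adj u x := (SimpleGraph.mem_edgeSet H).mp (SimpleGraph.mem_edgeFinset.mp (hex ▸ hF he))
  have huy : H.Adj u y := (SimpleGraph.mem_edgeSet H).mp (SimpleGraph.mem_edgeFinset.mp (hfy ▸ hF hf))
  have hxy' : H.Adj x y := (SimpleGraph.mem_edgeSet H).mp (SimpleGraph.mem_edgeFinset.mp (hgxy ▸ hF hg))
  exact hfree {u, x, y} (SimpleGraph.is3Clique_triple_iff.mpr ⟨hux, huy, hxy'⟩)

/-- `offAdjPairs + |F| = |F|²` iff every two distinct off-edges share a vertex. -/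
theorem offAdjPairs_eq_iff (H : SimpleGraph V) [DecidableRel H.Adj] (w : V) :
    offAdjPairs H w + (offEdges H w).card = (offEdges H w).card * (offEdges H w).card ↔
      ∀ e ∈ offEdges H w, ∀ f ∈ offEdges H w, e ≠ f → ∃ v, v ∈ e ∧ v ∈ f := by
  unfold offAdjPairs
  have hsub : (offEdges H w).offDiag.filter (fun p : Sym2 V × Sym2 V => ∃ v, v ∈ p.1 ∧ v ∈ p.2) ⊆
      (offEdges H w).offDiag := filter_subset _ _
  have hle := Nat.le_mul_self (offEdges H w).card
  constructor
  · intro h e he f hf hef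
    have hcard : (offEdges H w).offDiag.card ≤
        ((offEdges H w).offDiag.filter (fun p : Sym2 V × Sym2 V => ∃ v, v ∈ p.1 ∧ v ∈ p.2)).card := by
      rw [offDiag_card]
      omega
    have heq := eq_of_subset_of_card_le hsub hcard
    have : (e, f) ∈ (offEdges H w).offDiag.filter (fun p : Sym2 V × Sym2 V => ∃ v, v ∈ p.1 ∧ v ∈ p.2) := by
      rw [heq, mem_offDiag]
      exact ⟨he, hf, hef⟩
    exact (mem_filter.mp this).2
  · intro h
    have heq : (offEdges H w).offDiag.filter (fun p : Sym2 V × Sym2 V => ∃ v, v ∈ p.1 ∧ v ∈ p.2) =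
        (offEdges H w).offDiag := by
      rw [filter_eq_self]
      rintro ⟨e, f⟩ hp
      rw [mem_offDiag] at hp
      exact h e hp.1 f hp.2.1 hp.2.2
    rw [heq, offDiag_card]
    omega

/-- `attach = |F|` iff every off-edge meets `N(w)` in exactly one vertex (triangle-free). -/
theorem attach_eq_card_iff (H : SimpleGraph V) [DecidableRel H.Adj] (hfree : H.CliqueFree 3) (w : V) :
    attach H w = (offEdges H w).card ↔
      ∀ e ∈ offEdges H w, (univ.filter (fun v => H.Adj w v ∧ v ∈ e)).card = 1 := by
  rw [attach_eq_sum_card]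
  constructor
  · intro h e he
    by_contra hne
    have hlt : (univ.filter (fun v => H.Adj w v ∧ v ∈ e)).card < 1 := by
      have := card_adj_mem_le_one H hfree w e (mem_edgeFinset_of_mem_offEdges H w he)
      omega
    have hsum : ∑ e ∈ offEdges H w, (univ.filter (fun v => H.Adj w v ∧ v ∈ e)).card <
        ∑ _e ∈ offEdges H w, 1 :=
      sum_lt_sum (fun f hf => card_adj_mem_le_one H hfree w f (mem_edgeFinset_of_mem_offEdges H w hf))
        ⟨e, he, hlt⟩
    rw [sum_const, smul_eq_mul, mul_one] at hsum
    omega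
  · intro h
    rw [sum_congr rfl h, sum_const, smul_eq_mul, mul_one]

/-- **THE LEVEL LOCUS:** a triangle-free graph at the vertex bound of a non-isolated vertex `w` with `t ≥ 2`
off-edges has its off-edges forming a `t`-star at some vertex `u`, each meeting `N(w)` in exactly one vertex. -/
theorem level_locus (H : SimpleGraph V) [DecidableRel H.Adj] (hfree : H.CliqueFree 3) (w : V)
    (hw : 1 ≤ deg H w) (ht : 2 ≤ (offEdges H w).card)
    (heq : ∑ v, deg H v * deg H v + 2 * ((offEdges H w).card * (deg H w - 1)) =
      H.edgeFinset.card * (H.edgeFinset.card + 1)) :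
    ∃ u, (∀ e ∈ offEdges H w, u ∈ e) ∧
      ∀ e ∈ offEdges H w, (univ.filter (fun v => H.Adj w v ∧ v ∈ e)).card = 1 := by
  obtain ⟨hA, hP⟩ := (vertex_bound_eq_iff H hfree w hw).2.mp heq
  have hpair := (offAdjPairs_eq_iff H w).mp hP
  obtain ⟨u, hu⟩ := common_vertex_of_pairwise_inter H hfree (offEdges H w)
    (fun e he => mem_edgeFinset_of_mem_offEdges H w he) ht hpair
  exact ⟨u, hu, (attach_eq_card_iff H hfree w).mp hA⟩

/-- **THE CONVERSE:** off-edges forming a star at `u`, each meeting `N(w)` in exactly one vertex, attain the vertex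
bound (triangle-free, `w` not isolated). -/
theorem vertex_bound_eq_of_star (H : SimpleGraph V) [DecidableRel H.Adj] (hfree : H.CliqueFree 3) (w : V)
    (hw : 1 ≤ deg H w) (u : V) (hu : ∀ e ∈ offEdges H w, u ∈ e)
    (hmeet : ∀ e ∈ offEdges H w, (univ.filter (fun v => H.Adj w v ∧ v ∈ e)).card = 1) :
    ∑ v, deg H v * deg H v + 2 * ((offEdges H w).card * (deg H w - 1)) =
      H.edgeFinset.card * (H.edgeFinset.card + 1) := by
  rw [(vertex_bound_eq_iff H hfree w hw).2]
  refine ⟨(attach_eq_card_iff H hfree w).mpr hmeet, (offAdjPairs_eq_iff H w).mpr ?_⟩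
  intro e he f hf _
  exact ⟨u, hu e he, hu f hf⟩

end C047

end TriangleCap

end PercRepro
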